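import Literature.AnabelianGeometry.SemiGraphs.ThetaRayExoticMaximalCompactAnchorFree
import Literature.AnabelianGeometry.SemiGraphs.ThetaRayAnchorFreePair
import Literature.AnabelianGeometry.SemiGraphs.TemperedVerticialNamedFactsProofs
import HarnessLib

/-!
# [SemiAnbd] Thm 3.7 (iv) RE-CLOSED at the instance forms of record: ANCHORED subgroups (locally finite `𝒢`)
# and the ESCAPING procyclic compact of `π₁^temp(𝒢_θ)`

Mochizuki, *Semi-graphs of anabelioids*, Publ. RIMS **42** (2006), §3, Theorem 3.7 (iv), manuscript p. 41
[cite: MochizukiSemiAnbd2006, Thm 3.7(iv) p.41]: "The maximal compact subgroups of `π₁^temp(𝒢)` are precisely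
the verticial subgroups. The nontrivial intersections of two distinct maximal compact subgroups of `π₁^temp(𝒢)`
are precisely the edge-like subgroups."

PROOF-ONLY sibling of the DEFS-FROZEN node file `TemperedVerticial.lean` (cell abc-iut, layer L3, cone node
`SemiAnbd:Thm3.7(iv)`, kernel id `N_SemiAnbd_Thm3_7_iv`; seat abc-iut-w5-d162 gen 8, floor row of abc-iut-L3-lead
γ46 «K4 RE-CLOSE of F-1750 at the anchored / escaping-pair instances»; 0 definitions, no new named fact).

The node's ∀-countable typing `ProfiniteSemiGraph.MaximalCompactIffVerticial` (FACT row F-1750) is REFUTED AS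
TYPED in the kernel (`not_maximalCompactIffVerticial`, abc-iut-w6-d120, at abc-iut-L3-d1's locally finite
countermodel `𝒢_θ(p, n)`, where an ANCHOR-FREE procyclic maximal compact subgroup exists).  This file assembles,
BY NAME and without restating anything, the statement of Thm 3.7 (iv) IN THE NODE'S OWN SHAPE at the two
surviving instance forms of record:

* **anchored instances** (abc-iut-w6-d062, `TemperedMaximalCompactAnchoredOfLocallyFinite`): at every countable
  LOCALLY FINITE `𝒢` satisfying the hypotheses of Thm 3.7 and in every chart, BOTH clauses of (iv) hold verbatim
  once the subgroup `K` of clause 1, resp. one member `K₁` of the pair of clause 2, is ANCHORED (meets some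
  verticial subgroup nontrivially) — `maximalCompactIffVerticial_anchored_of_isLocallyFinite`; consequently the
  per-graph typed form `MaximalCompactIffVerticialAt 𝒢` holds at such a `𝒢` IFF every nontrivial maximal compact
  subgroup is anchored — `maximalCompactIffVerticialAt_iff_forall_anchored_of_isLocallyFinite` (the exact content
  of the kernel refutation: (iv) fails precisely through anchor-free maximal compact subgroups);
* **escaping instance** (abc-iut-L3-d4, `ThetaRayAnchorFreePair`): at `𝒢_θ(p, n)` (every schedule `n_k → ∞`,
  canonical chart) the escaping procyclic compact `C = closure⟨c⟩` is an ANCHOR-FREE MAXIMAL compact subgroup which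
  is the UNIQUE maximal compact subgroup containing any power `c^{p^m}`; hence a maximal compact `K ≠ C` contains
  no power `c^{p^m}`, i.e. clause 2 of (iv) cannot fail at `𝒢_θ` through a pair `(C, K)` sharing a power of `c`
  — `thetaRayFreeProP_exists_anchorFree_maximalCompact_unique_above_powers`,
  `thetaRayFreeProP_exists_anchorFree_maximalCompact_pow_not_mem_of_ne`; and the anchored form of (iv) holds at
  `𝒢_θ` itself in every chart — `thetaRayFreeProP_maximalCompactIffVerticial_anchored`.

Honest label: RE-CLOSED AT THE CARRIERS OF RECORD ≠ proved in print; the residual of clause 2 at `𝒢_θ` is the pair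
of two anchor-free maximal compact subgroups NOT sharing a power of `c` (abc-iut-L3-d4's banked row
«B9-GENERAL-PAIR»: escape of arbitrary anchor-free elements); nothing here asserts Thm 3.7 (iv) for an arbitrary
countable `𝔾`; nothing bears on [IUTchIII] Cor. 3.12; typed ≠ proved.
-/

noncomputable section

namespace Literature.AnabelianGeometry.SemiGraphs

namespace ProfiniteSemiGraph

open Filter Topology

universe u

variable (𝒢 : ProfiniteSemiGraph.{u})

/-! ### Thm 3.7 (iv) in the node's shape, for ANCHORED subgroups, at every locally finite `𝒢` -/

/-- **[SemiAnbd] Thm 3.7 (iv) — both clauses, verbatim in the shape of the node's typing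
`MaximalCompactIffVerticial`, for ANCHORED subgroups** (at every countable locally finite `𝒢` satisfying the
hypotheses of Thm 3.7, in every chart): (1) an anchored subgroup `K` (i.e. `K ⊓ H₀ ≠ 1` for some verticial `H₀`)
is maximal compact iff it is verticial; (2) a nontrivial `L` is the intersection `K₁ ⊓ K₂` of two distinct
maximal compact subgroups with `K₁` anchored iff `L` is an edge-like subgroup of a closed edge.  Assembled BY NAME
from abc-iut-w6-d062's `isMaximalCompactSubgroup_iff_mem_verticialSubgroups_of_anchored_of_isLocallyFinite`,
`exists_mem_edgeLikeSubgroups_of_maximalCompact_inf_of_anchored_of_isLocallyFinite`,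
`isMaximalCompactSubgroup_of_mem_verticialSubgroups_of_isLocallyFinite` and abc-iut-f-173's
`edgeLikeIsInfVerticialAt_holds`. [cite: MochizukiSemiAnbd2006, Thm 3.7(iv) p.41] -/
theorem maximalCompactIffVerticial_anchored_of_isLocallyFinite (h37 : 𝒢.Thm37Hypotheses)
    (hlf : 𝒢.graph.IsLocallyFinite) (c : TemperedPiChart 𝒢) :
    (∀ K : Subgroup c.G,
        (∃ (v₀ : 𝒢.graph.Vertex) (H₀ : Subgroup c.G), H₀ ∈ verticialSubgroups c v₀ ∧ K ⊓ H₀ ≠ ⊥) →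
          (IsMaximalCompactSubgroup K ↔ ∃ v, K ∈ verticialSubgroups c v)) ∧
      ∀ L : Subgroup c.G, L ≠ ⊥ →
        ((∃ K₁ K₂ : Subgroup c.G, IsMaximalCompactSubgroup K₁ ∧ IsMaximalCompactSubgroup K₂ ∧ K₁ ≠ K₂ ∧
            (∃ (v₀ : 𝒢.graph.Vertex) (H₀ : Subgroup c.G), H₀ ∈ verticialSubgroups c v₀ ∧ K₁ ⊓ H₀ ≠ ⊥) ∧
              L = K₁ ⊓ K₂) ↔
          ∃ e, 𝒢.graph.IsClosedEdge e ∧ L ∈ edgeLikeSubgroups c e) := by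
  refine ⟨fun K hK => ?_, fun L hL => ⟨?_, ?_⟩⟩
  · obtain ⟨v₀, H₀, hH₀, hanch⟩ := hK
    exact 𝒢.isMaximalCompactSubgroup_iff_mem_verticialSubgroups_of_anchored_of_isLocallyFinite h37 hlf c K
      hH₀ hanch
  · rintro ⟨K₁, K₂, hK₁, hK₂, hne, ⟨v₀, H₀, hH₀, hanch⟩, rfl⟩
    exact 𝒢.exists_mem_edgeLikeSubgroups_of_maximalCompact_inf_of_anchored_of_isLocallyFinite h37 hlf c
      hK₁ hK₂ hne hL hH₀ hanch
  · rintro ⟨e, he, hLe⟩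
    obtain ⟨v₁, v₂, H₁, H₂, hH₁, hH₂, hH, rfl⟩ := edgeLikeIsInfVerticialAt_holds 𝒢 h37 c e he _ hLe hL
    refine ⟨H₁, H₂, 𝒢.isMaximalCompactSubgroup_of_mem_verticialSubgroups_of_isLocallyFinite h37 hlf c hH₁,
      𝒢.isMaximalCompactSubgroup_of_mem_verticialSubgroups_of_isLocallyFinite h37 hlf c hH₂, hH,
      ⟨v₁, H₁, hH₁, ?_⟩, rfl⟩
    rw [inf_idem]
    exact fun h => hL (eq_bot_iff.mpr (inf_le_left.trans h.le))

/-- **The per-graph typed Thm 3.7 (iv) holds at a locally finite `𝒢` IFF every nontrivial maximal compact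
subgroup is anchored** (countable `𝒢` satisfying the hypotheses of Thm 3.7): `⇒` a maximal compact subgroup is
verticial, hence anchored at itself; `⇐` by `maximalCompactIffVerticial_anchored_of_isLocallyFinite` (a trivial
maximal compact subgroup forces every verticial subgroup to be trivial, and verticial subgroups exist by
Thm 3.7 (i), `verticialInjective_holds`).  This is the exact content of the kernel refutation of the ∀-form
(`not_maximalCompactIffVerticial`): (iv) fails at a locally finite Thm-3.7 graph only through an ANCHOR-FREE
maximal compact subgroup. [cite: MochizukiSemiAnbd2006, Thm 3.7(iv) p.41] -/
theorem maximalCompactIffVerticialAt_iff_forall_anchored_of_isLocallyFinite (h37 : 𝒢.Thm37Hypotheses)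
    (hlf : 𝒢.graph.IsLocallyFinite) :
    MaximalCompactIffVerticialAt 𝒢 ↔
      ∀ (c : TemperedPiChart 𝒢) (K : Subgroup c.G), IsMaximalCompactSubgroup K → K ≠ ⊥ →
        ∃ (v₀ : 𝒢.graph.Vertex) (H₀ : Subgroup c.G), H₀ ∈ verticialSubgroups c v₀ ∧ K ⊓ H₀ ≠ ⊥ := by
  constructor
  · intro h c K hK hKne
    obtain ⟨v, hKv⟩ := ((h h37 c).1 K).mp hK
    exact ⟨v, K, hKv, by rwa [inf_idem]⟩
  · intro hanch h37' c
    obtain ⟨h1, h2⟩ := 𝒢.maximalCompactIffVerticial_anchored_of_isLocallyFinite h37 hlf c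
    refine ⟨fun K => ⟨fun hK => ?_, fun ⟨v, hK⟩ =>
      𝒢.isMaximalCompactSubgroup_of_mem_verticialSubgroups_of_isLocallyFinite h37 hlf c hK⟩,
      fun L hL => ⟨?_, fun h => ?_⟩⟩
    · by_cases hKne : K = ⊥
      · -- a trivial maximal compact subgroup: every verticial subgroup is trivial, and one exists
        obtain ⟨v⟩ := h37.hasVertex
        obtain ⟨H, hH⟩ := (verticialInjective_holds 𝒢 h37 c v).1
        have hHK : H = K := hK.2 H (isCompact_of_mem_verticialSubgroups c hH) (hKne ▸ bot_le)
        exact ⟨v, hHK ▸ hH⟩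
      · exact (h1 K (hanch c K hK hKne)).mp hK
    · rintro ⟨K₁, K₂, hK₁, hK₂, hne, rfl⟩
      have hK₁ne : K₁ ≠ ⊥ := fun h => hL (eq_bot_iff.mpr (inf_le_left.trans h.le))
      exact (h2 _ hL).mp ⟨K₁, K₂, hK₁, hK₂, hne, hanch c K₁ hK₁ hK₁ne, rfl⟩
    · obtain ⟨K₁, K₂, hK₁, hK₂, hne, -, hLK⟩ := (h2 L hL).mpr h
      exact ⟨K₁, K₂, hK₁, hK₂, hne, hLK⟩

/-! ### The escaping instance at `𝒢_θ(p, n)` -/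

variable (p : ℕ) [hp : Fact p.Prime] (n : ℕ → ℕ)

/-- **At `𝒢_θ(p, n)` (canonical chart, every schedule `n_k → ∞`): the escaping procyclic compact
`C = closure⟨c⟩` is an ANCHOR-FREE MAXIMAL compact subgroup and the UNIQUE maximal compact subgroup containing any
power `c ^ p ^ m`** — abc-iut-L3-d4's `thetaRayFreeProP_exists_compact_unique_above_powers` (every compact
`K ∋ c^{p^m}` lies in `C`) read through maximality (`m = 0`: `C` is maximal compact) and abc-iut-L3-d4's
dichotomy `isMaximalCompactSubgroup_dichotomy_of_isLocallyFinite` (`C` lies in no verticial subgroup, so meets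
each trivially). [cite: MochizukiSemiAnbd2006, Thm 3.7(iv) p.41] -/
theorem thetaRayFreeProP_exists_anchorFree_maximalCompact_unique_above_powers (hn : Tendsto n atTop atTop)
    (h36 : (thetaRayFreeProP p n).Prop36Hypotheses) (h37 : (thetaRayFreeProP p n).Thm37Hypotheses) :
    ∃ c : ((thetaRayFreeProP p n).temperedPiChart h36).G,
      IsMaximalCompactSubgroup (Subgroup.zpowers c).topologicalClosure ∧
      (∀ (v : ℕ) (H : Subgroup ((thetaRayFreeProP p n).temperedPiChart h36).G),
        H ∈ verticialSubgroups ((thetaRayFreeProP p n).temperedPiChart h36) v →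
          (Subgroup.zpowers c).topologicalClosure ⊓ H = ⊥) ∧
      ∀ (K : Subgroup ((thetaRayFreeProP p n).temperedPiChart h36).G), IsMaximalCompactSubgroup K →
        ∀ m : ℕ, c ^ p ^ m ∈ K → K = (Subgroup.zpowers c).topologicalClosure := by
  obtain ⟨c, hCc, hCv, huniq⟩ := thetaRayFreeProP_exists_compact_unique_above_powers p n hn h36
  have hcC : c ∈ (Subgroup.zpowers c).topologicalClosure :=
    Subgroup.le_topologicalClosure _ (Subgroup.mem_zpowers c)
  have hCmax : IsMaximalCompactSubgroup (Subgroup.zpowers c).topologicalClosure :=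
    ⟨hCc, fun K hK hCK => le_antisymm (huniq 0 K hK (by rw [pow_zero, pow_one]; exact hCK hcC)) hCK⟩
  refine ⟨c, hCmax, ?_, fun K hK m hm => (hK.2 _ hCc (huniq m K hK.1 hm)).symm⟩
  rcases isMaximalCompactSubgroup_dichotomy_of_isLocallyFinite h37 SemiGraph.ray_isLocallyFinite _ _ hCmax with
    ⟨v, hCv'⟩ | hfree
  · exact absurd le_rfl (hCv v _ hCv')
  · exact hfree

/-- **Clause 2 of Thm 3.7 (iv) cannot fail at `𝒢_θ(p, n)` through a pair sharing a power of `c`**: for the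
anchor-free maximal compact `C = closure⟨c⟩` of the previous theorem, every OTHER maximal compact subgroup `K ≠ C`
contains none of the powers `c ^ p ^ m` (so `C ⊓ K` contains no such power).
[cite: MochizukiSemiAnbd2006, Thm 3.7(iv) p.41] -/
theorem thetaRayFreeProP_exists_anchorFree_maximalCompact_pow_not_mem_of_ne (hn : Tendsto n atTop atTop)
    (h36 : (thetaRayFreeProP p n).Prop36Hypotheses) (h37 : (thetaRayFreeProP p n).Thm37Hypotheses) :
    ∃ c : ((thetaRayFreeProP p n).temperedPiChart h36).G,
      IsMaximalCompactSubgroup (Subgroup.zpowers c).topologicalClosure ∧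
      (∀ (v : ℕ) (H : Subgroup ((thetaRayFreeProP p n).temperedPiChart h36).G),
        H ∈ verticialSubgroups ((thetaRayFreeProP p n).temperedPiChart h36) v →
          (Subgroup.zpowers c).topologicalClosure ⊓ H = ⊥) ∧
      ∀ (K : Subgroup ((thetaRayFreeProP p n).temperedPiChart h36).G), IsMaximalCompactSubgroup K →
        K ≠ (Subgroup.zpowers c).topologicalClosure → ∀ m : ℕ, c ^ p ^ m ∉ K := by
  obtain ⟨c, hCmax, hfree, huniq⟩ :=
    thetaRayFreeProP_exists_anchorFree_maximalCompact_unique_above_powers p n hn h36 h37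
  exact ⟨c, hCmax, hfree, fun K hK hne m hm => hne (huniq K hK m hm)⟩

/-- **Thm 3.7 (iv) for ANCHORED subgroups HOLDS at the countermodel `𝒢_θ(p, n)` itself, in every chart** (the
ray is locally finite): the instance of `maximalCompactIffVerticial_anchored_of_isLocallyFinite` at the very graph
where the ∀-typed form is refuted (`thetaRayFreeProP_not_maximalCompactIffVerticialAt`).
[cite: MochizukiSemiAnbd2006, Thm 3.7(iv) p.41] -/
theorem thetaRayFreeProP_maximalCompactIffVerticial_anchored (h37 : (thetaRayFreeProP p n).Thm37Hypotheses)
    (c : TemperedPiChart (thetaRayFreeProP p n)) :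
    (∀ K : Subgroup c.G,
        (∃ (v₀ : ℕ) (H₀ : Subgroup c.G), H₀ ∈ verticialSubgroups c v₀ ∧ K ⊓ H₀ ≠ ⊥) →
          (IsMaximalCompactSubgroup K ↔ ∃ v, K ∈ verticialSubgroups c v)) ∧
      ∀ L : Subgroup c.G, L ≠ ⊥ →
        ((∃ K₁ K₂ : Subgroup c.G, IsMaximalCompactSubgroup K₁ ∧ IsMaximalCompactSubgroup K₂ ∧ K₁ ≠ K₂ ∧
            (∃ (v₀ : ℕ) (H₀ : Subgroup c.G), H₀ ∈ verticialSubgroups c v₀ ∧ K₁ ⊓ H₀ ≠ ⊥) ∧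
              L = K₁ ⊓ K₂) ↔
          ∃ e, (thetaRayFreeProP p n).graph.IsClosedEdge e ∧ L ∈ edgeLikeSubgroups c e) :=
  (thetaRayFreeProP p n).maximalCompactIffVerticial_anchored_of_isLocallyFinite h37 SemiGraph.ray_isLocallyFinite c

end ProfiniteSemiGraph

end Literature.AnabelianGeometry.SemiGraphs

end
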